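import Literature.Analysis.FunctionSpaces.DuBoisReymondAE
import HarnessLib

/-!
# Energy bound for a finite COUPLED family of Galerkin modes

Analysis/FluidPDE proof-support file (everything proved; no definitions, no named facts).  The
scalar one-mode energy bound `PassiveScalarDiagUniqueness.sq_norm_le_of_ae_eq_setIntegral`
(`α' = −ν α + β`, `|β|² ≤ 2νDγ` ⇒ `|α(t)|² ≤ D ∫₀ᵗ γ`) treats ONE decoupled Fourier mode.  Here is
its twin for a finite family of modes `cᵢ`, `i ∈ ι`, coupled through a constant COERCIVE matrix `M`
(Evans 2010, §7.1.2 Thm. 2, Step 1 — the energy estimate of the Galerkin system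
`d/dt d^k_m + Σ_l e^{kl} d^l_m = f^k`, with the coercivity of the bilinear form in place of a
diagonal damping):

  `cᵢ(t) = ∫_{(0,t]} (−(M c)ᵢ + βᵢ)` a.e. on `(0,T)`,  `ν Σ|vᵢ|² ≤ Re Σᵢ v̄ᵢ (M v)ᵢ` for all `v`,
  `Σᵢ |βᵢ|² ≤ 2 ν D γ` a.e.  ⟹  `Σᵢ |cᵢ(t)|² ≤ D ∫_{(0,t]} γ` for a.e. `t ∈ (0,T)`

(`sum_sq_norm_le_of_ae_eq_setIntegral`).  Proof as in the scalar file: the continuous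
representatives `Cᵢ(t) = ∫_{(0,t]} (−(M c)ᵢ + βᵢ)` solve the same system with `C` in place of `c`
(they agree a.e.), the product formula for primitives
(`FunctionSpaces.mul_eq_add_setIntegral_of_eq_add_setIntegral`) applied to the real and imaginary
parts of each `Cᵢ` gives `Σ|Cᵢ(t)|² = ∫_{(0,t]} 2 Re Σᵢ C̄ᵢ(−(M C)ᵢ + βᵢ)`, and pointwise
`2 Re Σ C̄ᵢ(−(MC)ᵢ + βᵢ) ≤ −2ν|C|² + 2|C||β| ≤ |β|²/(2ν) ≤ Dγ`.

Used by the uniqueness theorem for weak passive-vector solutions with a constant fourth-order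
viscosity TENSOR (`PassiveVectorTensorUniqueness`): there the `d` tested mode equations of one wave
vector are coupled through the symbol matrix `T_𝔸(k)` and coercivity is the Legendre–Hadamard
window `NearIso 𝔸 lo hi`, `0 < lo` (cell `ad-ideate`, route `SolenoidalFractalHomogenisation`).

## Mathlib / tree search

Tree: `DuBoisReymondAE` (`FunctionSpaces.mul_eq_add_setIntegral_of_eq_add_setIntegral`),
`PassiveScalarDiagUniqueness.sq_norm_le_of_ae_eq_setIntegral` (scalar twin, `ι = Unit`, `M = ν`).
Mathlib: `integral_re`, `integral_im`, `integral_finsetSum`.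

## References

* L. C. Evans, *Partial Differential Equations*, 2nd ed. (AMS 2010), §7.1.2 Thm. 2 (energy
  estimates for the Galerkin approximations), §6.2.2 (coercivity / energy estimates for the
  bilinear form). [`Evans2010`]
-/

noncomputable section

open MeasureTheory Set Filter Function TopologicalSpace Complex
open scoped ComplexConjugate

namespace Literature.Analysis.FluidPDE

section CoupledModes

variable {ι : Type*} [Fintype ι]

omit [Fintype ι] in
/-- `Re(z̄ w) = Re z Re w + Im z Im w`. [folklore] -/
private theorem re_conj_mul (z w : ℂ) : (conj z * w).re = z.re * w.re + z.im * w.im := by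
  simp [Complex.mul_re]

omit [Fintype ι] in
/-- `|Re(z̄ w)| ≤ |z| |w|`, one-sided. [folklore] -/
private theorem re_conj_mul_le (z w : ℂ) : (conj z * w).re ≤ ‖z‖ * ‖w‖ := by
  calc (conj z * w).re ≤ ‖conj z * w‖ := Complex.re_le_norm _
    _ = ‖z‖ * ‖w‖ := by rw [norm_mul, Complex.norm_conj]

omit [Fintype ι] in
/-- AM–GM with a weight: for `ν > 0`, `x y ≤ ν x² + y²/(4ν)`. [folklore] -/
private theorem mul_le_weighted_sq {ν : ℝ} (hν : 0 < ν) (x y : ℝ) :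
    x * y ≤ ν * x ^ 2 + y ^ 2 / (4 * ν) := by
  have h : 0 ≤ (2 * ν * x - y) ^ 2 / (4 * ν) := by positivity
  have e : (2 * ν * x - y) ^ 2 / (4 * ν) = ν * x ^ 2 + y ^ 2 / (4 * ν) - x * y := by
    field_simp
    ring
  linarith [h, e]

/-- **Pointwise step.** For a coercive matrix (`ν Σ|vᵢ|² ≤ Re Σ v̄ᵢ (Mv)ᵢ`), `ν, D, c ≥ 0` and
`Σᵢ |bᵢ|² ≤ 2νDc`: `2 Σᵢ (Re Cᵢ · Re φᵢ + Im Cᵢ · Im φᵢ) ≤ D c` where `φᵢ = −(M C)ᵢ + bᵢ`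
(`= 2 Re Σ C̄ᵢ φᵢ ≤ −2ν|C|² + 2|C||b| ≤ Dc`). [cite: Evans2010, §7.1.2 Thm. 2 (Step 1)] -/
private theorem two_mul_sum_re_mul_le {ν D c : ℝ} (hν : 0 ≤ ν) (hD : 0 ≤ D) (hc : 0 ≤ c)
    (M : ι → ι → ℂ)
    (hM : ∀ v : ι → ℂ, ν * ∑ i, ‖v i‖ ^ 2 ≤ (∑ i, conj (v i) * ∑ j, M i j * v j).re)
    (C b : ι → ℂ) (hb : ∑ i, ‖b i‖ ^ 2 ≤ 2 * ν * D * c) :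
    2 * ∑ i, ((C i).re * (-(∑ j, M i j * C j) + b i).re + (C i).im * (-(∑ j, M i j * C j) + b i).im) ≤
      D * c := by
  -- rewrite as real parts of `C̄ᵢ φᵢ` and split
  have e1 : ∀ i, (C i).re * (-(∑ j, M i j * C j) + b i).re + (C i).im * (-(∑ j, M i j * C j) + b i).im =
      -(conj (C i) * ∑ j, M i j * C j).re + (conj (C i) * b i).re := by
    intro i
    rw [← re_conj_mul, mul_add, Complex.add_re, mul_neg, Complex.neg_re]
  simp_rw [e1]
  rw [Finset.sum_add_distrib, Finset.sum_neg_distrib]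
  have hcoer := hM C
  rw [Complex.re_sum] at hcoer
  rcases hν.eq_or_lt with h0 | hpos
  · -- `ν = 0`: then `b = 0`
    subst h0
    have hb0 : ∀ i, b i = 0 := by
      intro i
      have h1 : ∑ j, ‖b j‖ ^ 2 ≤ 0 := by simpa using hb
      have h2 : ‖b i‖ ^ 2 ≤ 0 :=
        (Finset.single_le_sum (f := fun j => ‖b j‖ ^ 2) (fun j _ => sq_nonneg _) (Finset.mem_univ i)).trans h1
      have h3 : ‖b i‖ = 0 := by nlinarith [norm_nonneg (b i)]
      exact norm_eq_zero.1 h3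
    simp only [hb0, mul_zero, Complex.zero_re, Finset.sum_const_zero, add_zero]
    rw [zero_mul] at hcoer
    nlinarith [hcoer, mul_nonneg hD hc]
  · have hterm : ∀ i, (conj (C i) * b i).re ≤ ν * ‖C i‖ ^ 2 + ‖b i‖ ^ 2 / (4 * ν) := fun i =>
      (re_conj_mul_le _ _).trans (mul_le_weighted_sq hpos _ _)
    have hsum : ∑ i, (conj (C i) * b i).re ≤ ν * ∑ i, ‖C i‖ ^ 2 + (∑ i, ‖b i‖ ^ 2) / (4 * ν) := by
      rw [Finset.mul_sum, Finset.sum_div, ← Finset.sum_add_distrib]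
      exact Finset.sum_le_sum fun i _ => hterm i
    have hb' : (∑ i, ‖b i‖ ^ 2) / (4 * ν) ≤ D * c / 2 := by
      rw [div_le_iff₀ (by positivity)]
      nlinarith [hb]
    linarith

/-- A coercive-matrix image `s ↦ (M c(s))ᵢ` of integrable modes is integrable. [folklore] -/
private theorem integrableOn_matrix_apply {T : ℝ} (M : ι → ι → ℂ) {c : ι → ℝ → ℂ}
    (hc : ∀ i, IntegrableOn (c i) (Ioo 0 T)) (i : ι) :
    IntegrableOn (fun s => ∑ j, M i j * c j s) (Ioo 0 T) :=
  integrable_finsetSum _ fun j _ => (hc j).const_mul _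

/-- **Energy bound for a finite coupled family of modes.** Let `ι` be finite, `cᵢ, βᵢ : ℝ → ℂ`
integrable on `(0,T)`, `γ ≥ 0` integrable on `(0,T)`, `ν, D ≥ 0`, and `M` a constant matrix,
COERCIVE in the sense `ν Σᵢ|vᵢ|² ≤ Re Σᵢ v̄ᵢ (M v)ᵢ` for all `v : ι → ℂ`.  If
`cᵢ(t) = ∫_{(0,t]} (−(M c(s))ᵢ + βᵢ(s)) ds` for a.e. `t ∈ (0,T)` and every `i` (the coupled mode
system with zero datum, integrated) and `Σᵢ |βᵢ|² ≤ 2νDγ` a.e. on `(0,T)`, then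
`Σᵢ |cᵢ(t)|² ≤ D ∫_{(0,t]} γ` for a.e. `t ∈ (0,T)` (Evans' energy estimate for the Galerkin
system, Step 1 of §7.1.2 Thm. 2, in integrated a.e. form). [cite: Evans2010, §7.1.2 Thm. 2] -/
theorem sum_sq_norm_le_of_ae_eq_setIntegral {T ν D : ℝ} (hν : 0 ≤ ν) (hD : 0 ≤ D)
    (M : ι → ι → ℂ)
    (hM : ∀ v : ι → ℂ, ν * ∑ i, ‖v i‖ ^ 2 ≤ (∑ i, conj (v i) * ∑ j, M i j * v j).re)
    {c β : ι → ℝ → ℂ} {γ : ℝ → ℝ}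
    (hc : ∀ i, IntegrableOn (c i) (Ioo 0 T)) (hβ : ∀ i, IntegrableOn (β i) (Ioo 0 T))
    (hγ : IntegrableOn γ (Ioo 0 T)) (hγ0 : ∀ᵐ s ∂(volume.restrict (Ioo 0 T)), 0 ≤ γ s)
    (heq : ∀ i, ∀ᵐ t ∂(volume.restrict (Ioo 0 T)),
      c i t = ∫ s in Ioc 0 t, (-(∑ j, M i j * c j s) + β i s))
    (hbound : ∀ᵐ s ∂(volume.restrict (Ioo 0 T)), ∑ i, ‖β i s‖ ^ 2 ≤ 2 * ν * D * γ s) :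
    ∀ᵐ t ∂(volume.restrict (Ioo 0 T)), ∑ i, ‖c i t‖ ^ 2 ≤ D * ∫ s in Ioc 0 t, γ s := by
  rcases le_or_gt T 0 with hT0 | hT0
  · rw [Ioo_eq_empty_of_le hT0, Measure.restrict_empty, ae_zero]
    exact Filter.eventually_bot
  -- the continuous representatives
  set Cr : ι → ℝ → ℂ := fun i t => ∫ s in Ioc 0 t, (-(∑ j, M i j * c j s) + β i s) with hCr
  have hcC : ∀ᵐ t ∂(volume.restrict (Ioo 0 T)), ∀ i, c i t = Cr i t := ae_all_iff.2 heq
  -- a.e. statements on `(0,T)` transfer to `(0,T]`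
  have hT_ae : ∀ {p : ℝ → Prop}, (∀ᵐ s ∂(volume.restrict (Ioo 0 T)), p s) →
      ∀ᵐ s ∂(volume.restrict (Ioc 0 T)), p s := fun h => by
    rwa [← Measure.restrict_congr_set (Ioo_ae_eq_Ioc (μ := (volume : Measure ℝ)))]
  -- the integrands with `Cr` in place of `c`
  set φc : ι → ℝ → ℂ := fun i s => -(∑ j, M i j * Cr j s) + β i s with hφc
  have hφc_ae : ∀ᵐ s ∂(volume.restrict (Ioo 0 T)), ∀ i,
      -(∑ j, M i j * c j s) + β i s = φc i s := by
    filter_upwards [hcC] with s hs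
    intro i
    simp only [hφc, hs]
  have hφci : ∀ i, IntegrableOn (φc i) (Ioo 0 T) := fun i =>
    IntegrableOn.congr_fun_ae (((integrableOn_matrix_apply M hc i).neg).add (hβ i))
      (by filter_upwards [hφc_ae] with s hs using hs i)
  have hφciT : ∀ i, IntegrableOn (φc i) (Ioc 0 T) := fun i =>
    (integrableOn_Ioc_iff_integrableOn_Ioo (f := φc i)).2 (hφci i)
  have hφre : ∀ i, IntegrableOn (fun s => (φc i s).re) (Ioo 0 T) := fun i => (hφci i).re
  have hφim : ∀ i, IntegrableOn (fun s => (φc i s).im) (Ioo 0 T) := fun i => (hφci i).im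
  -- `Cr i t = ∫_{(0,t]} φc i` for every `t ∈ (0,T]`
  have hCeq : ∀ i, ∀ t ∈ Ioc 0 T, Cr i t = ∫ s in Ioc 0 t, φc i s := by
    intro i t ht
    rw [hCr]
    refine setIntegral_congr_ae measurableSet_Ioc ?_
    have h1 : ∀ᵐ s ∂(volume : Measure ℝ), s ∈ Ioc 0 T → -(∑ j, M i j * c j s) + β i s = φc i s := by
      have h2 := (ae_restrict_iff' measurableSet_Ioc).1 (hT_ae hφc_ae)
      filter_upwards [h2] with s hs hsT using hs hsT i
    filter_upwards [h1] with s hs hst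
    exact hs (Ioc_subset_Ioc_right ht.2 hst)
  -- real and imaginary parts of each representative
  have hFeq : ∀ i, ∀ t ∈ Ioc 0 T, (Cr i t).re = 0 + ∫ s in Ioc 0 t, (φc i s).re := by
    intro i t ht
    have hi : Integrable (φc i) (volume.restrict (Ioc 0 t)) := (hφciT i).mono_set (Ioc_subset_Ioc_right ht.2)
    rw [zero_add, hCeq i t ht]
    exact (integral_re hi).symm
  have hGeq : ∀ i, ∀ t ∈ Ioc 0 T, (Cr i t).im = 0 + ∫ s in Ioc 0 t, (φc i s).im := by
    intro i t ht
    have hi : Integrable (φc i) (volume.restrict (Ioc 0 t)) := (hφciT i).mono_set (Ioc_subset_Ioc_right ht.2)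
    rw [zero_add, hCeq i t ht]
    exact (integral_im hi).symm
  -- the bound for the representatives at every `t ∈ (0,T]`
  have hCbound : ∀ t ∈ Ioc 0 T, ∑ i, ‖Cr i t‖ ^ 2 ≤ D * ∫ s in Ioc 0 t, γ s := by
    intro t ht
    -- per-mode product formulas
    have hmode : ∀ i, IntegrableOn (fun s => (φc i s).re * (Cr i s).re + (Cr i s).re * (φc i s).re +
        ((φc i s).im * (Cr i s).im + (Cr i s).im * (φc i s).im)) (Ioc 0 t) ∧
        ‖Cr i t‖ ^ 2 = ∫ s in Ioc 0 t, ((φc i s).re * (Cr i s).re + (Cr i s).re * (φc i s).re +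
          ((φc i s).im * (Cr i s).im + (Cr i s).im * (φc i s).im)) := by
      intro i
      obtain ⟨i1, e1⟩ := FunctionSpaces.mul_eq_add_setIntegral_of_eq_add_setIntegral (hφre i)
        (hφre i) (hFeq i) (hFeq i) ht
      obtain ⟨i2, e2⟩ := FunctionSpaces.mul_eq_add_setIntegral_of_eq_add_setIntegral (hφim i)
        (hφim i) (hGeq i) (hGeq i) ht
      refine ⟨i1.add i2, ?_⟩
      have hnorm : ‖Cr i t‖ ^ 2 = (Cr i t).re * (Cr i t).re + (Cr i t).im * (Cr i t).im := by
        rw [Complex.sq_norm, Complex.normSq_apply]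
      rw [hnorm, e1, e2, zero_mul, zero_add, zero_add, ← integral_add i1 i2]
    have hall : IntegrableOn (fun s => ∑ i, ((φc i s).re * (Cr i s).re + (Cr i s).re * (φc i s).re +
        ((φc i s).im * (Cr i s).im + (Cr i s).im * (φc i s).im))) (Ioc 0 t) :=
      integrable_finsetSum _ fun i _ => (hmode i).1
    have esum : ∑ i, ‖Cr i t‖ ^ 2 = ∫ s in Ioc 0 t, ∑ i, ((φc i s).re * (Cr i s).re + (Cr i s).re * (φc i s).re +
        ((φc i s).im * (Cr i s).im + (Cr i s).im * (φc i s).im)) := by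
      rw [integral_finsetSum _ fun i _ => (hmode i).1]
      exact Finset.sum_congr rfl fun i _ => (hmode i).2
    rw [esum]
    have hγt : IntegrableOn γ (Ioc 0 t) :=
      ((integrableOn_Ioc_iff_integrableOn_Ioo (f := γ)).2 hγ).mono_set (Ioc_subset_Ioc_right ht.2)
    rw [← integral_const_mul]
    refine integral_mono_ae hall (hγt.const_mul D) ?_
    have hb : ∀ᵐ s ∂(volume.restrict (Ioc 0 t)), (∑ i, ‖β i s‖ ^ 2 ≤ 2 * ν * D * γ s) ∧ 0 ≤ γ s :=
      ae_restrict_of_ae_restrict_of_subset (Ioc_subset_Ioc_right ht.2) (hT_ae (hbound.and hγ0))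
    filter_upwards [hb] with s hs
    have key := two_mul_sum_re_mul_le hν hD hs.2 M hM (fun i => Cr i s) (fun i => β i s) hs.1
    have e : ∑ i, ((φc i s).re * (Cr i s).re + (Cr i s).re * (φc i s).re +
        ((φc i s).im * (Cr i s).im + (Cr i s).im * (φc i s).im)) =
        2 * ∑ i, ((Cr i s).re * (-(∑ j, M i j * Cr j s) + β i s).re +
          (Cr i s).im * (-(∑ j, M i j * Cr j s) + β i s).im) := by
      rw [Finset.mul_sum]
      refine Finset.sum_congr rfl fun i _ => ?_
      simp only [hφc]
      ring
    rw [e]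
    exact key
  -- back to `c`
  filter_upwards [hcC, ae_restrict_mem measurableSet_Ioo] with t ht htT
  simp only [ht]
  exact hCbound t ⟨htT.1, htT.2.le⟩

end CoupledModes

end Literature.Analysis.FluidPDE

end
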